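import Literature.Claims.NS.Thambynayagam2015
import Literature.Analysis.FluidPDE.BurgersVortexLayerSteady
import HarnessLib

/-!
# C38 `Thambynayagam2015` — kernel facts for the claims map (refuter-4, NS-CLAIMS SWEEP D-0090)

R. K. M. Thambynayagam, *POSER* (arXiv:1509.08766 v3), skeleton
`Literature.Claims.NS.Thambynayagam2015` (typist-2 g2, p478141).

This file certifies the ERRATUM / class-restriction column of the row (referee ref-2 g2's F3 call:
an aside, not the locator): **Step 3 `Display45` is false for the abstract's data class.**
(4.5)–(4.7) p. 6 assert that the heat flow of EVERY smooth solenoidal periodic datum is separable,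
`v⁽¹⁾(x,t) = v⁽⁰⁾(x) e^{−ξ₁π²κt}`; a two-shell shear datum refutes it:
`v⁰(x) = (sin 2πx₀ + sin 4πx₀) e₁`, whose heat flow (`κ = 1`)
`w(t,x) = (e^{−4π²t} sin 2πx₀ + e^{−16π²t} sin 4πx₀) e₁` is a certified `IsLinearStep 1 v⁰ 0 w`
(smooth on `ℝ³ × [0,∞)`, `ℤ³`-periodic, divergence free, `∂ₜw = Δw`) and is not of the form
`e^{−ξ₁π²t} v⁰` (test points `x₀ = 1/4`, `x₀ = 1/8` at `t = 1`). Every closed form (4.14)–(4.38) of §4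
rests on (4.5). The locator of record (Step 6 `PlateauReached`, the exact plateau of the
«instantaneous sequence») is adjudicated on STATUS; it is not touched here.

Credit: the construction and proof text of `not_Display45` are typist-2 g2's kill-aid scratch
(`claims/Thambynayagam2015/kill-Display45.typist2-scratch.lean`, sha16 210df5e5df686712), adopted
with renamed declarations and docstrings.

WHAT THIS IS NOT: not a claim about NS regularity or blow-up; not a claim about any author beyond
the typed locator.
-/

set_option linter.dupNamespace false

noncomputable section

open Set Function Real
open scoped ContDiff Laplacian RealInnerProductSpace

namespace Summit.NavierStokesRegularity.NavierStokesRegularity.Theorems.Thambynayagam2015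

open Literature.Analysis.FluidPDE Literature.Analysis.FluidPDE.StrainedShear
open Literature.Claims.NS.Thambynayagam2015


/-! ### The two-shell shear profile and its heat flow -/

/-- The two-shell profile at time `t`: `V_t(s) = e^{−4π²t} sin(2πs) + e^{−16π²t} sin(4πs)`
(wavenumbers `2π` and `4π`: two Laplace shells). -/
def twoShellProfile (t s : ℝ) : ℝ :=
  Real.exp (-(4 * π ^ 2 * t)) * Real.sin (2 * π * s) +
    Real.exp (-(16 * π ^ 2 * t)) * Real.sin (4 * π * s)

/-- `∂ₛ` of the two-shell profile. -/
def twoShellProfile' (t s : ℝ) : ℝ :=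
  Real.exp (-(4 * π ^ 2 * t)) * (2 * π * Real.cos (2 * π * s)) +
    Real.exp (-(16 * π ^ 2 * t)) * (4 * π * Real.cos (4 * π * s))

/-- `∂ₛ²` of the two-shell profile. -/
def twoShellProfile'' (t s : ℝ) : ℝ :=
  Real.exp (-(4 * π ^ 2 * t)) * (-(2 * π) ^ 2 * Real.sin (2 * π * s)) +
    Real.exp (-(16 * π ^ 2 * t)) * (-(4 * π) ^ 2 * Real.sin (4 * π * s))

/-- The two-shell heat flow `w(t,x) = V_t(x₀) e₁` (a unidirectional shear, tree `StrainedShear.shear`). -/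
def twoShellFlow (t : ℝ) : EuclideanSpace ℝ (Fin 3) → EuclideanSpace ℝ (Fin 3) :=
  shear (twoShellProfile t)

/-- The spatial derivative of the profile. -/
theorem hasDerivAt_twoShellProfile (t s : ℝ) :
    HasDerivAt (twoShellProfile t) (twoShellProfile' t s) s := by
  have hs : ∀ c : ℝ, HasDerivAt (fun s => Real.sin (c * s)) (c * Real.cos (c * s)) s := fun c => by
    simpa [mul_comm] using ((hasDerivAt_id s).const_mul c).sin
  unfold twoShellProfile twoShellProfile'
  exact ((hs _).const_mul _).add ((hs _).const_mul _)

/-- The second spatial derivative of the profile. -/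
theorem hasDerivAt_twoShellProfile' (t s : ℝ) :
    HasDerivAt (twoShellProfile' t) (twoShellProfile'' t s) s := by
  have hc : ∀ c : ℝ, HasDerivAt (fun s => Real.cos (c * s)) (-(c * Real.sin (c * s))) s := fun c => by
    simpa [mul_comm] using ((hasDerivAt_id s).const_mul c).cos
  unfold twoShellProfile' twoShellProfile''
  have h1 := ((hc (2 * π)).const_mul (2 * π)).const_mul (Real.exp (-(4 * π ^ 2 * t)))
  have h2 := ((hc (4 * π)).const_mul (4 * π)).const_mul (Real.exp (-(16 * π ^ 2 * t)))
  refine (h1.add h2).congr_deriv ?_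
  ring

/-- The profile is smooth in `s`. -/
theorem contDiff_twoShellProfile (t : ℝ) {n : WithTop ℕ∞} : ContDiff ℝ n (twoShellProfile t) := by
  unfold twoShellProfile; fun_prop

/-- The time derivative of the profile at fixed `s` (each shell decays at its own rate). -/
theorem hasDerivAt_twoShellProfile_time (t s : ℝ) :
    HasDerivAt (fun τ => twoShellProfile τ s)
      (Real.exp (-(4 * π ^ 2 * t)) * (-(4 * π ^ 2)) * Real.sin (2 * π * s) +
        Real.exp (-(16 * π ^ 2 * t)) * (-(16 * π ^ 2)) * Real.sin (4 * π * s)) t := by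
  unfold twoShellProfile
  have h1 : HasDerivAt (fun τ => Real.exp (-(4 * π ^ 2 * τ)))
      (Real.exp (-(4 * π ^ 2 * t)) * (-(4 * π ^ 2))) t := by
    have := ((hasDerivAt_id t).const_mul (-(4 * π ^ 2))).exp
    simpa [neg_mul] using this
  have h2 : HasDerivAt (fun τ => Real.exp (-(16 * π ^ 2 * τ)))
      (Real.exp (-(16 * π ^ 2 * t)) * (-(16 * π ^ 2))) t := by
    have := ((hasDerivAt_id t).const_mul (-(16 * π ^ 2))).exp
    simpa [neg_mul] using this
  exact (h1.mul_const _).add (h2.mul_const _)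

/-- Joint smoothness of `(t,x) ↦ w(t,x)` on all of `ℝ × EuclideanSpace ℝ (Fin 3)`. -/
theorem contDiff_uncurry_twoShellFlow : ContDiff ℝ ∞ (uncurry twoShellFlow) := by
  have h0 : ContDiff ℝ ∞ fun p : ℝ × EuclideanSpace ℝ (Fin 3) => p.2 0 :=
    (EuclideanSpace.proj (0 : Fin 3) : EuclideanSpace ℝ (Fin 3) →L[ℝ] ℝ).contDiff.comp contDiff_snd
  have hV : ContDiff ℝ ∞ fun p : ℝ × EuclideanSpace ℝ (Fin 3) => twoShellProfile p.1 (p.2 0) := by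
    unfold twoShellProfile
    have h1 : ContDiff ℝ ∞ fun p : ℝ × EuclideanSpace ℝ (Fin 3) => p.1 := contDiff_fst
    fun_prop
  have : uncurry twoShellFlow = fun p : ℝ × EuclideanSpace ℝ (Fin 3) => twoShellProfile p.1 (p.2 0) • eOne := by
    funext p; rfl
  rw [this]
  exact hV.smul contDiff_const

/-- The heat flow is `ℤ³`-periodic at every time. -/
theorem isLatticePeriodic_twoShellFlow (t : ℝ) : IsLatticePeriodic (twoShellFlow t) := by
  intro j x
  simp only [twoShellFlow, shear]
  congr 1
  by_cases hj : j = 0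
  · subst hj
    have hx : (x + EuclideanSpace.single (0 : Fin 3) (1 : ℝ)) 0 = x 0 + 1 := by simp
    rw [hx]
    unfold twoShellProfile
    have e1 : Real.sin (2 * π * (x 0 + 1)) = Real.sin (2 * π * x 0) := by
      rw [show 2 * π * (x 0 + 1) = 2 * π * x 0 + 2 * π by ring, Real.sin_add_two_pi]
    have e2 : Real.sin (4 * π * (x 0 + 1)) = Real.sin (4 * π * x 0) := by
      rw [show 4 * π * (x 0 + 1) = 4 * π * x 0 + (2 : ℕ) * (2 * π) by push_cast; ring,
        Real.sin_add_nat_mul_two_pi]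
    rw [e1, e2]
  · have hx : (x + EuclideanSpace.single j (1 : ℝ)) 0 = x 0 := by
      simp [Ne.symm hj]
    rw [hx]

/-- The heat flow is divergence free (a shear: component `1` depends on `x₀` only). -/
theorem isDivFree_twoShellFlow (t : ℝ) : VectorCalculus.IsDivFree (twoShellFlow t) := by
  intro x
  rw [divergence_eq_sum_inner_fderiv (EuclideanSpace.basisFun (Fin 3) ℝ)]
  simp only [Fin.sum_univ_three, EuclideanSpace.basisFun_apply, twoShellFlow,
    fderiv_shear_apply (hasDerivAt_twoShellProfile t), EuclideanSpace.inner_single_left, map_one,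
    one_mul]
  simp [eOne]

/-- The heat equation `∂ₜw = 1·Δw − 0` on `EuclideanSpace ℝ (Fin 3) × [0,∞)` (one-sided time derivative within `Ici 0`). -/
theorem eqn_twoShellFlow (t : ℝ) (ht : 0 ≤ t) (x : EuclideanSpace ℝ (Fin 3)) :
    timeDerivWithin (Ici 0) twoShellFlow t x =
      (1 : ℝ) • (Δ (twoShellFlow t)) x - (0 : ℝ → EuclideanSpace ℝ (Fin 3) → EuclideanSpace ℝ (Fin 3)) t x := by
  rw [timeDerivWithin_apply]
  have hfun : (fun s => twoShellFlow s x) = fun s => twoShellProfile s (x 0) • eOne := by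
    funext s; rfl
  rw [hfun, ((hasDerivAt_twoShellProfile_time t (x 0)).smul_const eOne).hasDerivWithinAt.derivWithin
    (uniqueDiffOn_Ici 0 t ht)]
  rw [show twoShellFlow t = shear (twoShellProfile t) from rfl,
    laplacian_shear ((contDiff_twoShellProfile t).of_le le_top) (hasDerivAt_twoShellProfile t)
      (hasDerivAt_twoShellProfile' t) x]
  simp only [Pi.zero_apply, sub_zero, one_smul]
  congr 1
  unfold twoShellProfile''
  ring

/-- **The two-shell heat flow is a certified Sequence-1 step** (`IsLinearStep 1 v⁰ 0 w`, `v⁰ = w(0)`):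
smooth on `EuclideanSpace ℝ (Fin 3) × [0,∞)`, periodic, divergence free, `w(·,0) = v⁰`, `∂ₜw = Δw`. -/
theorem isLinearStep_twoShellFlow : IsLinearStep 1 (twoShellFlow 0) 0 twoShellFlow where
  smooth := contDiff_uncurry_twoShellFlow.contDiffOn
  periodic t _ := isLatticePeriodic_twoShellFlow t
  divFree t _ := isDivFree_twoShellFlow t
  initial := rfl
  eqn t ht x := eqn_twoShellFlow t ht x

/-- The datum `v⁰ = w(0) = (sin 2πx₀ + sin 4πx₀) e₁` is in the abstract's class `IsDatum`
(smooth, solenoidal, `ℤ³`-periodic). -/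
theorem isDatum_twoShellFlow_zero : IsDatum (twoShellFlow 0) := by
  refine ⟨contDiff_shear (contDiff_twoShellProfile 0), ?_, isLatticePeriodic_twoShellFlow 0⟩
  intro x
  exact isDivFree_twoShellFlow 0 x

/-- The profile at `t = 1`. -/
theorem twoShellProfile_one (s : ℝ) : twoShellProfile 1 s =
    Real.exp (-(4 * π ^ 2)) * Real.sin (2 * π * s) + Real.exp (-(16 * π ^ 2)) * Real.sin (4 * π * s) := by
  simp [twoShellProfile]

/-- The profile at `t = 0` (the datum's profile). -/
theorem twoShellProfile_zero (s : ℝ) : twoShellProfile 0 s = Real.sin (2 * π * s) + Real.sin (4 * π * s) := by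
  simp [twoShellProfile]

/-- The four sine values at the test points `x₀ = 1/4` and `x₀ = 1/8`. [folklore] -/
theorem sin_test_values :
    Real.sin (2 * π * (1 / 4)) = 1 ∧ Real.sin (4 * π * (1 / 4)) = 0 ∧
      Real.sin (2 * π * (1 / 8)) = Real.sqrt 2 / 2 ∧ Real.sin (4 * π * (1 / 8)) = 1 := by
  refine ⟨?_, ?_, ?_, ?_⟩
  · rw [show 2 * π * (1 / 4) = π / 2 by ring]; exact Real.sin_pi_div_two
  · rw [show 4 * π * (1 / 4) = π by ring]; exact Real.sin_pi
  · rw [show 2 * π * (1 / 8) = π / 4 by ring]; exact Real.sin_pi_div_four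
  · rw [show 4 * π * (1 / 8) = π / 2 by ring]; exact Real.sin_pi_div_two

/-- Component `1` of `w t (c e₀)` is `V_t(c)`. -/
theorem twoShellFlow_apply_one (t c : ℝ) :
    twoShellFlow t (EuclideanSpace.single 0 c) 1 = twoShellProfile t c := by
  simp [twoShellFlow, shear, eOne]

/-- **Step 3 `Display45` ((4.5)–(4.7) p. 6) is false for the abstract's data class** [erratum /
class-restriction column; NOT the locator of record]: the two-shell heat flow is a Sequence-1 step of a
datum in `IsDatum` and is not `e^{−ξ₁π²κt} v⁰` for any `ξ₁` — at `x₀ = 1/4` the identity forces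
`e^{−ξ₁π²} = e^{−4π²}`, at `x₀ = 1/8` it then forces `e^{−16π²} = e^{−4π²}`. (Typist-2 g2's kill-aid,
adopted.) [cite: Thambynayagam2015, (4.5)–(4.7) p.6] -/
theorem not_Display45 : ¬ Display45 := by
  intro H
  obtain ⟨ξ, _, hw⟩ := H 1 one_pos (twoShellFlow 0) isDatum_twoShellFlow_zero twoShellFlow
    isLinearStep_twoShellFlow
  have h1 := congrArg (fun v : EuclideanSpace ℝ (Fin 3) => v 1) (hw 1 zero_le_one (EuclideanSpace.single 0 (1 / 4 : ℝ)))
  have h2 := congrArg (fun v : EuclideanSpace ℝ (Fin 3) => v 1) (hw 1 zero_le_one (EuclideanSpace.single 0 (1 / 8 : ℝ)))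
  simp only [PiLp.smul_apply, smul_eq_mul, twoShellFlow_apply_one, twoShellProfile_one,
    twoShellProfile_zero] at h1 h2
  obtain ⟨s1, s2, s3, s4⟩ := sin_test_values
  rw [s1, s2] at h1
  rw [s3, s4] at h2
  have hE : Real.exp (-(16 * π ^ 2)) = Real.exp (-(4 * π ^ 2)) := by
    nlinarith [h1, h2, Real.sqrt_nonneg 2]
  have := Real.exp_injective hE
  nlinarith [Real.pi_pos]

/-- The same flow shows that the separable ansatz fails for EVERY candidate rate, uniformly in the
statement's shape: no `ξ₁ : ℝ` (positive or not) makes `w(1,·) = e^{−ξ₁π²} v⁰`. -/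
theorem twoShellFlow_not_separable (ξ₁ : ℝ) :
    ¬ ∀ x : EuclideanSpace ℝ (Fin 3), twoShellFlow 1 x = Real.exp (-(ξ₁ * π ^ 2 * 1 * 1)) • twoShellFlow 0 x := by
  intro hw
  have h1 := congrArg (fun v : EuclideanSpace ℝ (Fin 3) => v 1) (hw (EuclideanSpace.single 0 (1 / 4 : ℝ)))
  have h2 := congrArg (fun v : EuclideanSpace ℝ (Fin 3) => v 1) (hw (EuclideanSpace.single 0 (1 / 8 : ℝ)))
  simp only [PiLp.smul_apply, smul_eq_mul, twoShellFlow_apply_one, twoShellProfile_one,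
    twoShellProfile_zero] at h1 h2
  obtain ⟨s1, s2, s3, s4⟩ := sin_test_values
  rw [s1, s2] at h1
  rw [s3, s4] at h2
  have hE : Real.exp (-(16 * π ^ 2)) = Real.exp (-(4 * π ^ 2)) := by
    nlinarith [h1, h2, Real.sqrt_nonneg 2]
  have := Real.exp_injective hE
  nlinarith [Real.pi_pos]

end Summit.NavierStokesRegularity.NavierStokesRegularity.Theorems.Thambynayagam2015

end

-- WHAT THIS IS NOT: not a claim about NS regularity or blow-up; not a claim about any author beyond the
-- typed locator.
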